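import Summits.BirchSwinnertonDyer.BirchSwinnertonDyer.Theorems.SignedLowerHalvesKobayashiLowerHalfLargeImageParityStratumFE
import Summits.BirchSwinnertonDyer.BirchSwinnertonDyer.Theses.SignedLowerHalves
import HarnessLib

/-!
# Route `SignedLowerHalves` (K3), crux 4 `KobayashiMainConjectureSmallImage`, child 4 = item stmt-BirchSwinnertonDyer-23118
# `SmallImageLambdaLowerAtThree` (the `p`-inverted `λ`-part of the Eisenstein half at `p = 3`, small image):
# the child BY NAME ⟺ its OFF-STRATUM part modulo print — on every sign `ε` with `(μ, λ)(L_3^ε) = (0, ≤ 1)` the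
# `λ`-shape holds by PARITY (slh-p1's `kobayashiLowerDivisibility_of_lam_le_one'`, no image hypothesis)

Cell `bsd-ssimc`, seat `bsd-line-slh-p3` LEAD gen 12 (helper file `--supports stmt-BirchSwinnertonDyer-23118`; CALIBRATION /
SUPPORT ONLY: the item is NOT closed; no stub of the line of record is touched). HONEST FRAMING: every theorem is CONDITIONAL
on DISPLAYED binders — Kobayashi 2003 Thm. 1.2 (`h12`), the period-unit facts (`h5`, `h3`), the `p`-parity theorem
(`hpar`) — and, for the by-name statements, on the OFF-STRATUM part of the item itself. THEOREMS ONLY; no definition, no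
named fact, no `sorry`; BSD / crux 4 / item 23118 NOT proved.

## Why

Item 23118 asks, at `p = 3` on the small-image non-CM `a_3 = 0` rows, for EACH sign `ε` and every signed dual datum
`D`: `char X^ε = (g)` with `(3^m · g)^ℚ = ϖ · (L_3^ε · h)^ℚ` — the Eisenstein half cut to its `p`-inverted `λ`-part.
The INTEGRAL Eisenstein half `KobayashiLowerDivisibility W p ε` (`m = 0`) implies it trivially
(`lambdaLowerShape_of_kobayashiLowerDivisibility`), and seat `bsd-line-slh-p1` LEAD g12 proved the integral half at
EVERY odd good `p` with `a_p = 0` for every sign carrying the certificate `(μ, λ)(L_p^ε) = (0, ≤ 1)`, with NO image,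
rank or Kato hypothesis (`LargeImageParityStratum.kobayashiLowerDivisibility_of_lam_le_one'`: `T ∣ ξ^ε` by parity,
`(L_p^ε) = (T)` or `Λ` by the certificate, Sprung's functional equation a tree theorem). Hence (§2) the item's content
modulo print is carried ENTIRELY by the signs `ε` at small-image `p = 3` pairs with `λ(L_3^ε) ≥ 2` or `μ(L_3^ε) ≥ 1`
— the same reading the parity stratum gives for crux 3 (`…LargeImageParityStratumCrux`) and, with Conjecture A, for
crux 4 (`…SmallImageParityStratum`).

## What is proved

* §1 (per pair and sign; any odd good `p`, `a_p = 0`, ANY image) `lambdaLowerShape_of_kobayashiLowerDivisibility`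
  (integral ⟹ `p`-inverted, `m = 0`), `lambdaLowerShape_of_lam_le_one` (certificate `(0, ≤ 1)` ⟹ the `λ`-shape for
  that sign, granted `h12 h5 h3 hpar`).
* §2 `smallImageLambdaLowerAtThree_of_offStratum` — item 23118 BY NAME ⟸ `h12 h5 h3` ∧ `hpar` ∧ «the `λ`-shape at every
  OFF-stratum sign of a small-image `p = 3` pair»; `offStratum_of_smallImageLambdaLowerAtThree` (converse, trivial);
  `smallImageLambdaLowerAtThree_iff_offStratum`.

References: [Kobayashi2003] Thm. 1.2, Conjecture (p. 2); [DokchitserDokchitserAnnals2010] Thm. 1.4; [Sprung2017]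
Cor. 4.14; [GreenbergVatsal2000] p. 4; [Pollack2003] Prop. 6.18. Tree: `…LargeImageParityStratum{,FE}` (slh-p1 LEAD g12).
-/

set_option autoImplicit false
set_option linter.dupNamespace false

noncomputable section

open scoped Classical MatrixGroups ModularForm

open CongruenceSubgroup PowerSeries WeierstrassCurve Field Literature.NumberTheory.EllipticCurves
  Literature.NumberTheory.EllipticCurves.ModularForms
  Literature.NumberTheory.EllipticCurves.Rank1Residual Literature.NumberTheory.EllipticCurves.Sprung2017
  Literature.NumberTheory.EllipticCurves.Kobayashi2003 ZpExtension
  Literature.NumberTheory.EllipticCurves.Rank1Residual.Typed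
  Summit.BirchSwinnertonDyer.Rank1Residual.X1.MuLambda
  Summit.BirchSwinnertonDyer.Rank1Residual.Supersingular

namespace Summit.BirchSwinnertonDyer.BirchSwinnertonDyer.Theorems.SmallImageLambdaThreeParityStratum

/-! ## §1. The `p`-inverted `λ`-shape for ONE sign at ONE pair, on the parity stratum -/

section PerSign

variable (W : WeierstrassCurve ℚ) [W.IsElliptic] [W.IsGloballyMinimal] (p : ℕ) [Fact p.Prime]

/-- **The integral Eisenstein half implies its `p`-inverted `λ`-shape** (`m = 0`): `KobayashiLowerDivisibility W p ε`
gives, for every `(κ, γ, f, ϖ, L^±, D)` of the binder, `char X^ε = (g)` with `(p^0 · g)^ℚ = ϖ · (L_p^ε · h)^ℚ`.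
[cite: Kobayashi2003, Conjecture (Main Conjecture) (p. 2)] -/
theorem lambdaLowerShape_of_kobayashiLowerDivisibility {ε : ℤˣ} (h : KobayashiLowerDivisibility W p ε)
    (κ : ZpExtension ℚ p) (γ : absoluteGaloisGroup ℚ) (hκ : κ.IsCyclotomic) (hγ : κ.IsTopGenerator γ)
    (hγ' : IsCyclotomicVariable p γ) [NeZero (W.conductorNorm ℤ)] (f : CuspForm (Gamma0 (W.conductorNorm ℤ)) 2)
    (hf : IsNewformOf W f) (ϖ : ℚ) (hϖ : (ϖ : ℝ) * W.realPeriodRat = plusPeriod f)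
    (Lplus Lminus : IwasawaAlgebra p) (hPP : IsPollackPair f p Lplus Lminus) (D : SignedSelmerDualData W κ γ ε) :
    ∃ (g h : IwasawaAlgebra p) (m : ℕ), D.charIdeal = Ideal.span {g} ∧
      iwasawaToPowerSeries p (PowerSeries.C ((p : ℤ_[p]) ^ m) * g) =
        PowerSeries.C (ϖ : ℚ_[p]) * iwasawaToPowerSeries p (kobayashiL ε Lplus Lminus * h) := by
  obtain ⟨g, h', hg, hι⟩ := h κ γ hκ hγ hγ' f hf ϖ hϖ Lplus Lminus hPP D
  refine ⟨g, h', 0, hg, ?_⟩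
  rw [pow_zero, map_one, one_mul]
  exact hι

/-- **The `λ`-shape for a `(0, ≤ 1)`-certified sign, ANY image, ANY rank**: odd good `p`, `a_p = 0`, `f₀` the newform of
level `N_E`, and Pollack's `L_p^ε` with `μ = 0`, `λ ≤ 1`; granted `h12`, `h5`, `h3`, `hpar` BY NAME. Then the integral
Eisenstein half holds (`LargeImageParityStratum.kobayashiLowerDivisibility_of_lam_le_one'`), hence the `p`-inverted
shape. [cite: Kobayashi2003, Thm. 1.2 and Conjecture (p. 2)] [cite: DokchitserDokchitserAnnals2010, Thm. 1.4]
[cite: Sprung2017, Cor. 4.14 (a_p = 0 display)] -/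
theorem lambdaLowerShape_of_lam_le_one
    (h12 : Kobayashi2003.thm12_signedSelmerDual_finite_torsion)
    (h5 : realPeriodRat_eq_unit_mul_plusPeriod) (h3 : realPeriodRat_eq_unit_mul_plusPeriod_three)
    (hpar : p_parity W p) (hp : p ≠ 2) (hgood : W.HasGoodReductionAtPrime p) (hap : W.frobeniusTrace p = 0)
    (ε : ℤˣ) [NeZero (W.conductorNorm ℤ)] {f₀ : CuspForm (Gamma0 (W.conductorNorm ℤ)) 2} (hf₀ : IsNewformOf W f₀)
    (hcert₀ : ∀ L : IwasawaAlgebra p, IsSignedPAdicLFunction f₀ p ε L → mu L = 0 ∧ lam L ≤ 1)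
    (κ : ZpExtension ℚ p) (γ : absoluteGaloisGroup ℚ) (hκ : κ.IsCyclotomic) (hγ : κ.IsTopGenerator γ)
    (hγ' : IsCyclotomicVariable p γ) (f : CuspForm (Gamma0 (W.conductorNorm ℤ)) 2)
    (hf : IsNewformOf W f) (ϖ : ℚ) (hϖ : (ϖ : ℝ) * W.realPeriodRat = plusPeriod f)
    (Lplus Lminus : IwasawaAlgebra p) (hPP : IsPollackPair f p Lplus Lminus) (D : SignedSelmerDualData W κ γ ε) :
    ∃ (g h : IwasawaAlgebra p) (m : ℕ), D.charIdeal = Ideal.span {g} ∧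
      iwasawaToPowerSeries p (PowerSeries.C ((p : ℤ_[p]) ^ m) * g) =
        PowerSeries.C (ϖ : ℚ_[p]) * iwasawaToPowerSeries p (kobayashiL ε Lplus Lminus * h) :=
  lambdaLowerShape_of_kobayashiLowerDivisibility W p
    (LargeImageParityStratum.kobayashiLowerDivisibility_of_lam_le_one' W p h12 h5 h3 hpar hp hgood hap ε hf₀ hcert₀)
    κ γ hκ hγ hγ' f hf ϖ hϖ Lplus Lminus hPP D

end PerSign

/-! ## §2. Item 23118 BY NAME ⟺ its off-stratum part, modulo print -/

section Item

/-- **Item 23118 `SmallImageLambdaLowerAtThree` BY NAME from its OFF-STRATUM part and the prints.** Hypotheses BY NAME: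
`h12 h5 h3`, `hpar` (for every `(W, p)`), and `hoff` — at every `p = 3`, X7, ¬CM, `a_3 = 0`, ¬Surj pair and every
SIGN `ε` such that for the newform `f₀` of level `N_E` Pollack's `L_3^ε` has `λ ≥ 2` whenever `μ = 0`, the item's
`λ`-shape conclusion for that `(W, ε)`. Proof: per sign, either the certificate `(0, ≤ 1)` holds for the decl's newform
and §1 applies, or (uniqueness `IsSignedPAdicLFunction.unique`) the sign is off the stratum and `hoff` applies.
CALIBRATION ONLY. [cite: Kobayashi2003, Thm. 1.2 and Conjecture (p. 2)] [cite: DokchitserDokchitserAnnals2010, Thm. 1.4]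
[cite: Sprung2017, Cor. 4.14 (a_p = 0 display)] [cite: Pollack2003, Prop. 6.18] -/
theorem smallImageLambdaLowerAtThree_of_offStratum
    (h12 : Kobayashi2003.thm12_signedSelmerDual_finite_torsion)
    (h5 : realPeriodRat_eq_unit_mul_plusPeriod) (h3 : realPeriodRat_eq_unit_mul_plusPeriod_three)
    (hpar : ∀ (W : WeierstrassCurve ℚ) [W.IsElliptic] (p : ℕ) [Fact p.Prime], p_parity W p)
    (hoff : ∀ (W : WeierstrassCurve ℚ) [W.IsElliptic] [W.IsGloballyMinimal] (p : ℕ) [Fact p.Prime],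
      p = 3 → ClassX7 W p → ¬ W.HasCM → W.frobeniusTrace p = 0 → ¬ Surj W p → ∀ (ε : ℤˣ),
      (∀ [NeZero (W.conductorNorm ℤ)] (f₀ : CuspForm (Gamma0 (W.conductorNorm ℤ)) 2),
        IsNewformOf W f₀ → ∀ (L : IwasawaAlgebra p),
          IsSignedPAdicLFunction f₀ p ε L → mu L = 0 → 2 ≤ lam L) →
      ∀ (κ : ZpExtension ℚ p) (γ : absoluteGaloisGroup ℚ),
          κ.IsCyclotomic → κ.IsTopGenerator γ → IsCyclotomicVariable p γ →
        ∀ [NeZero (W.conductorNorm ℤ)] (f : CuspForm (Gamma0 (W.conductorNorm ℤ)) 2),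
          IsNewformOf W f → ∀ (ϖ : ℚ), (ϖ : ℝ) * W.realPeriodRat = plusPeriod f →
        ∀ (Lplus Lminus : IwasawaAlgebra p), IsPollackPair f p Lplus Lminus →
        ∀ (D : SignedSelmerDualData W κ γ ε),
          ∃ (g h : IwasawaAlgebra p) (m : ℕ), D.charIdeal = Ideal.span {g} ∧
            iwasawaToPowerSeries p (PowerSeries.C ((p : ℤ_[p]) ^ m) * g) =
              PowerSeries.C (ϖ : ℚ_[p]) * iwasawaToPowerSeries p (kobayashiL ε Lplus Lminus * h)) :
    Summit.BirchSwinnertonDyer.BirchSwinnertonDyer.Theses.SignedLowerHalves.SmallImageLambdaLowerAtThree := by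
  intro W _ _ p _ hp3 hX hCM hap hs ε κ γ hκ hγ hγ' _ f hf ϖ hϖ Lplus Lminus hPP D
  have hp : p ≠ 2 := by rw [hp3]; decide
  by_cases hon : ∀ L : IwasawaAlgebra p, IsSignedPAdicLFunction f p ε L → mu L = 0 ∧ lam L ≤ 1
  · -- on the stratum: §1
    exact lambdaLowerShape_of_lam_le_one W p h12 h5 h3 (hpar W p) hp hX.1.1 hap ε hf hon κ γ hκ hγ hγ' f hf
      ϖ hϖ Lplus Lminus hPP D
  · -- off the stratum: `hoff`
    refine hoff W p hp3 hX hCM hap hs ε (fun f₁ hf₁ L hL hμ ↦ ?_) κ γ hκ hγ hγ' f hf ϖ hϖ Lplus Lminus hPP D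
    have hff : f₁ = f := hf₁.unique hf
    subst hff
    by_contra hlt
    refine hon fun L' hL' ↦ ?_
    have hLL : L' = L := hL'.unique hL
    subst hLL
    exact ⟨hμ, by omega⟩

/-- **The converse (trivial): item 23118 implies its off-stratum part.** [cite: Kobayashi2003, Conjecture (p. 2)] -/
theorem offStratum_of_smallImageLambdaLowerAtThree
    (h : Summit.BirchSwinnertonDyer.BirchSwinnertonDyer.Theses.SignedLowerHalves.SmallImageLambdaLowerAtThree) :
    ∀ (W : WeierstrassCurve ℚ) [W.IsElliptic] [W.IsGloballyMinimal] (p : ℕ) [Fact p.Prime],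
      p = 3 → ClassX7 W p → ¬ W.HasCM → W.frobeniusTrace p = 0 → ¬ Surj W p → ∀ (ε : ℤˣ),
      (∀ [NeZero (W.conductorNorm ℤ)] (f₀ : CuspForm (Gamma0 (W.conductorNorm ℤ)) 2),
        IsNewformOf W f₀ → ∀ (L : IwasawaAlgebra p),
          IsSignedPAdicLFunction f₀ p ε L → mu L = 0 → 2 ≤ lam L) →
      ∀ (κ : ZpExtension ℚ p) (γ : absoluteGaloisGroup ℚ),
          κ.IsCyclotomic → κ.IsTopGenerator γ → IsCyclotomicVariable p γ →
        ∀ [NeZero (W.conductorNorm ℤ)] (f : CuspForm (Gamma0 (W.conductorNorm ℤ)) 2),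
          IsNewformOf W f → ∀ (ϖ : ℚ), (ϖ : ℝ) * W.realPeriodRat = plusPeriod f →
        ∀ (Lplus Lminus : IwasawaAlgebra p), IsPollackPair f p Lplus Lminus →
        ∀ (D : SignedSelmerDualData W κ γ ε),
          ∃ (g h : IwasawaAlgebra p) (m : ℕ), D.charIdeal = Ideal.span {g} ∧
            iwasawaToPowerSeries p (PowerSeries.C ((p : ℤ_[p]) ^ m) * g) =
              PowerSeries.C (ϖ : ℚ_[p]) * iwasawaToPowerSeries p (kobayashiL ε Lplus Lminus * h) :=
  fun W _ _ p _ hp3 hX hCM hap hs ε _ ↦ h W p hp3 hX hCM hap hs ε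

/-- **Item 23118 BY NAME ⟺ its off-stratum part, modulo `h12 h5 h3` and `p`-parity.** READING: the content of the
`p = 3` `λ`-part child of crux 4 beyond published theorems is carried entirely by the SIGNS `ε` at small-image `p = 3`
pairs whose `L_3^ε` has `λ ≥ 2` or `μ ≥ 1` (for a rank-`0` pair with `3 ∤ #Ш·Tam·…`-type unit value, or a rank-`1` pair
with unit `3`-adic regulator-type certificate on a sign, nothing is left). CALIBRATION ONLY.
[cite: Kobayashi2003, Thm. 1.2 and Conjecture (p. 2)] [cite: DokchitserDokchitserAnnals2010, Thm. 1.4]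
[cite: Sprung2017, Cor. 4.14 (a_p = 0 display)] -/
theorem smallImageLambdaLowerAtThree_iff_offStratum
    (h12 : Kobayashi2003.thm12_signedSelmerDual_finite_torsion)
    (h5 : realPeriodRat_eq_unit_mul_plusPeriod) (h3 : realPeriodRat_eq_unit_mul_plusPeriod_three)
    (hpar : ∀ (W : WeierstrassCurve ℚ) [W.IsElliptic] (p : ℕ) [Fact p.Prime], p_parity W p) :
    Summit.BirchSwinnertonDyer.BirchSwinnertonDyer.Theses.SignedLowerHalves.SmallImageLambdaLowerAtThree ↔
    ∀ (W : WeierstrassCurve ℚ) [W.IsElliptic] [W.IsGloballyMinimal] (p : ℕ) [Fact p.Prime],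
      p = 3 → ClassX7 W p → ¬ W.HasCM → W.frobeniusTrace p = 0 → ¬ Surj W p → ∀ (ε : ℤˣ),
      (∀ [NeZero (W.conductorNorm ℤ)] (f₀ : CuspForm (Gamma0 (W.conductorNorm ℤ)) 2),
        IsNewformOf W f₀ → ∀ (L : IwasawaAlgebra p),
          IsSignedPAdicLFunction f₀ p ε L → mu L = 0 → 2 ≤ lam L) →
      ∀ (κ : ZpExtension ℚ p) (γ : absoluteGaloisGroup ℚ),
          κ.IsCyclotomic → κ.IsTopGenerator γ → IsCyclotomicVariable p γ →
        ∀ [NeZero (W.conductorNorm ℤ)] (f : CuspForm (Gamma0 (W.conductorNorm ℤ)) 2),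
          IsNewformOf W f → ∀ (ϖ : ℚ), (ϖ : ℝ) * W.realPeriodRat = plusPeriod f →
        ∀ (Lplus Lminus : IwasawaAlgebra p), IsPollackPair f p Lplus Lminus →
        ∀ (D : SignedSelmerDualData W κ γ ε),
          ∃ (g h : IwasawaAlgebra p) (m : ℕ), D.charIdeal = Ideal.span {g} ∧
            iwasawaToPowerSeries p (PowerSeries.C ((p : ℤ_[p]) ^ m) * g) =
              PowerSeries.C (ϖ : ℚ_[p]) * iwasawaToPowerSeries p (kobayashiL ε Lplus Lminus * h) :=
  ⟨offStratum_of_smallImageLambdaLowerAtThree, smallImageLambdaLowerAtThree_of_offStratum h12 h5 h3 hpar⟩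

end Item

end Summit.BirchSwinnertonDyer.BirchSwinnertonDyer.Theorems.SmallImageLambdaThreeParityStratum

end
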